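import Summits.CriticalPhenomena.PercolationContinuityZ3.Theorems.PercNearOneGluingNoHeavyLowerTailQ44bPencilAtB
import Summits.CriticalPhenomena.PercolationContinuityZ3.Theorems.PercNearOneGluingNoHeavyLowerTailQ44bPencilIntoC
import HarnessLib

/-!
# `Q44b` for every finite weighted graph from the mixed coefficient at INTERNAL pairs of `a` only

Support file for crux `stmt-CriticalPhenomena-4575` (master-family programme, quadratic four-point row `Q44b` of
`prim-bnk-1` gen 13, OPEN for all `n`), seat `prim-l12-p6` gen 12; memo
`run/shared/lean/prim/prim-l12/FROM-prim-l12-p6-g12-K8-CENSUS.md` §7.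

The mixed reduction of gen 8 (`Q44b.row_nonneg_of_mixedAt`) asks for `PencilMixed w s(x,z)` at EVERY fractional pair
`s(x,z)` with `x` surely joined to `a`.  The pairs running into the sure cluster of a terminal are theorems:
`z ∈ [b]` (`Q44b.pencilMixed_of_sureJoined_b`, crossing-to-pendant exchange), `z ∈ [c]`
(`Q44b.pencilMixed_of_sureJoined_c`, `pencilAtC`), and `z ∈ [y]` by the `c ↔ y` symmetry of the row proved here
(`Q44b.bil_swap_cy`, `Q44b.pencilMixed_of_sureJoined_y`).  Hence

* `Q44b.MIXint` — HYPOTHESIS: the mixed coefficient is (conditionally) nonnegative along every fractional pair `s(x,z)`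
  with `x ∈ [a]` and `z` NOT surely joined to `b`, `c` or `y` ("internal neighbour of `a`'s cluster"); this is the
  law-level shadow `MIX(az) ≥ 0` of the fibre statements `H0_az / H2_az / B10(az) ≥ 0` of the graph route, 0 violations
  in every census to date (cp-key MULTISCALE-ADV: 0 / 17.1·10⁹; fibrewise on all graphs with ≤ 8 vertices, gen 12 §1);
* `Q44b.mixa_of_mixInt` and **`Q44b.row_nonneg_of_mixInt : MIXint n a b c y → ∀ w, 0 ≤ Q44b.row w a b c y`** —
  the law-level residual of `Q44b ∀n` is the internal `a`-pair alone.

One definition (`MIXint`, a hypothesis) and theorems; no named facts, no sorries, standard axioms.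
-/

noncomputable section

namespace Summit.CriticalPhenomena.PercolationContinuityZ3.Theorems

namespace Q44b

open MeasureTheory Set Literature.Probability.LatticeModels Literature.Probability.Percolation
open scoped Classical

variable {n : ℕ}

/-- Membership in `{u ↔ v}` (by `Iff.rfl`; local copy, cf. `knThm2_mem_openConn`). [folklore] -/
private theorem mem_oc (ω : BondConfig (Fin n)) (u v : Fin n) :
    ω ∈ (openConn u v : Set (BondConfig (Fin n))) ↔ (openGraph ω).Reachable u v := Iff.rfl

/-- `{u ↔ v} = {v ↔ u}` pointwise. [folklore] -/
private theorem reach_comm (ω : BondConfig (Fin n)) (u v : Fin n) :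
    (openGraph ω).Reachable u v ↔ (openGraph ω).Reachable v u :=
  ⟨SimpleGraph.Reachable.symm, SimpleGraph.Reachable.symm⟩

/-! ### The `c ↔ y` symmetry of the row -/

section swap

variable (a b c y : Fin n)

/-- `AC` is symmetric under `c ↔ y`. [this work] -/
theorem evAC_swap : evAC a b y c = evAC a b c y := by
  ext ω; simp only [evAC, mem_inter_iff, mem_oc, reach_comm ω y c]
/-- `∅` is symmetric under `c ↔ y`. [this work] -/
theorem evEmp_swap : evEmp a b y c = evEmp a b c y := by
  ext ω; simp only [evEmp, mem_inter_iff, mem_compl_iff, mem_oc, reach_comm ω y c]; tauto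
/-- `AΔ` is symmetric under `c ↔ y`. [this work] -/
theorem evAD_swap : evAD a b y c = evAD a b c y := by
  ext ω; simp only [evAD, mem_inter_iff, mem_compl_iff]; tauto
/-- `X` is symmetric under `c ↔ y`. [this work] -/
theorem evX_swap : evX a b y c = evX a b c y := by
  ext ω; simp only [evX, mem_inter_iff, mem_union, mem_compl_iff]; tauto
/-- `ab|c|y` is symmetric under `c ↔ y`. [this work] -/
theorem evAB_swap : evAB a b y c = evAB a b c y := by
  ext ω; simp only [evAB, mem_inter_iff, mem_compl_iff, mem_oc, reach_comm ω y c]; tauto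
/-- `C¬A` is symmetric under `c ↔ y`. [this work] -/
theorem evCnA_swap : evCnA a b y c = evCnA a b c y := by
  ext ω; simp only [evCnA, mem_inter_iff, mem_compl_iff, mem_oc, reach_comm ω y c]
/-- `a|bcy` is symmetric under `c ↔ y`. [this work] -/
theorem evPend_swap : evPend a b y c = evPend a b c y := by
  ext ω; simp only [evPend, mem_inter_iff, mem_compl_iff]; tauto
/-- `X′` is symmetric under `c ↔ y`. [this work] -/
theorem evXp_swap : evXp a b y c = evXp a b c y := by
  ext ω; simp only [evXp, mem_inter_iff, mem_union, mem_compl_iff]; tauto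

/-- The bilinear form of `Q44b` is symmetric under `c ↔ y`. [this work] -/
theorem bil_swap_cy (w w' : Sym2 (Fin n) → unitInterval) : bil w w' a b y c = bil w w' a b c y := by
  unfold bil
  rw [evAC_swap, evEmp_swap, evAD_swap, evX_swap, evAB_swap, evCnA_swap, evPend_swap, evXp_swap]

/-- Pencil concavity is symmetric under `c ↔ y`. [this work] -/
theorem pencilConcave_swap_cy (w : Sym2 (Fin n) → unitInterval) (e : Sym2 (Fin n)) :
    PencilConcave w e a b y c ↔ PencilConcave w e a b c y := by
  unfold PencilConcave
  simp only [bil_swap_cy]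

end swap

/-! ### Pairs into the sure cluster of `y` -/

/-- **`ND_a` at the pairs into `y`'s sure cluster** (from the `c`-case by the `c ↔ y` symmetry). [this work] -/
theorem pencilConcave_of_sureJoined_y (w : Sym2 (Fin n) → unitInterval) {a y x z : Fin n} (b c : Fin n)
    (hxz : x ≠ z) (hx : sureJoined (Function.update w s(x, z) 0) a x)
    (hz : sureJoined (Function.update w s(x, z) 0) y z) :
    PencilConcave w s(x, z) a b c y := by
  rw [← pencilConcave_swap_cy]
  exact pencilConcave_of_sureJoined_c w b c hxz hx hz

/-- Hence the mixed coefficient is (conditionally) nonnegative at the pairs into `y`'s sure cluster. [this work] -/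
theorem pencilMixed_of_sureJoined_y (w : Sym2 (Fin n) → unitInterval) {a y x z : Fin n} (b c : Fin n)
    (hxz : x ≠ z) (hx : sureJoined (Function.update w s(x, z) 0) a x)
    (hz : sureJoined (Function.update w s(x, z) 0) y z) :
    PencilMixed w s(x, z) a b c y :=
  pencilMixed_of_pencilConcave w s(x, z) a b c y (pencilConcave_of_sureJoined_y w b c hxz hx hz)

/-! ### The reduction to internal pairs -/

/-- **Hypothesis `MIX_int`** (the law-level residual of the `Q44b` programme): for every weighting and every
FRACTIONAL pair `s(x,z)` with `x` surely joined to `a` and `z` surely joined to NONE of `b, c, y` (after the pair is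
deleted), the mixed Bernstein coefficient of the pencil along `s(x,z)` is nonnegative whenever the row is nonnegative
at the two ends.  Numerically: 0 violations in cp-key's multi-scale census (MIX ≥ 0, 17.1·10⁹ exact instances) and,
fibrewise, on every graph with at most 8 vertices. [this work] -/
def MIXint (n : ℕ) (a b c y : Fin n) : Prop :=
  ∀ (w : Sym2 (Fin n) → unitInterval) (x z : Fin n), x ≠ z →
    sureJoined (Function.update w s(x, z) 0) a x →
      ¬ sureJoined (Function.update w s(x, z) 0) b z →
      ¬ sureJoined (Function.update w s(x, z) 0) c z →
      ¬ sureJoined (Function.update w s(x, z) 0) y z →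
        (w s(x, z) ≠ 0 ∧ w s(x, z) ≠ 1) → PencilMixed w s(x, z) a b c y

/-- `MIX_int ⇒ MIX_a`: the pairs into a terminal's sure cluster are discharged by
`pencilMixed_of_sureJoined_b / _c / _y`. [this work] -/
theorem mixa_of_mixInt (a b c y : Fin n) (h : MIXint n a b c y) : MIXa n a b c y := by
  intro w x z hxz hsure hfrac
  by_cases hb : sureJoined (Function.update w s(x, z) 0) b z
  · exact pencilMixed_of_sureJoined_b w c y hxz hsure hb
  by_cases hc : sureJoined (Function.update w s(x, z) 0) c z
  · exact pencilMixed_of_sureJoined_c w b y hxz hsure hc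
  by_cases hy : sureJoined (Function.update w s(x, z) 0) y z
  · exact pencilMixed_of_sureJoined_y w b c hxz hsure hy
  exact h w x z hxz hsure hb hc hy hfrac

/-- **`Q44b` for all `n` from the internal mixed coefficient**: `MIX_int ⇒ 0 ≤ Q44b(w)` for every weighting `w` of
the pairs of `Fin n` (all four terminals arbitrary). [this work] -/
theorem row_nonneg_of_mixInt (a b c y : Fin n) (h : MIXint n a b c y) (w : Sym2 (Fin n) → unitInterval) :
    0 ≤ row w a b c y :=
  row_nonneg_of_mixedAt a b c y (mixa_of_mixInt a b c y h) w

end Q44b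

end Summit.CriticalPhenomena.PercolationContinuityZ3.Theorems

end
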